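import Summits.KontsevichZagierPeriods.KontsevichZagierPeriods.Theorems.LinRedNormalFormHoffmanIndependenceZagierEquivalence
import Summits.KontsevichZagierPeriods.KontsevichZagierPeriods.Theorems.FurushoPentagonKernelModuloPeriodConjectureLeafWeightLeSeventeen
import Summits.KontsevichZagierPeriods.KontsevichZagierPeriods.Theorems.KernelModuloPeriodConjecture.Negative.StubAImpliesBrownSpanning

/-!
# Crux `LinRedNormalForm.HoffmanIndependence` (stmt-KontsevichZagierPeriods-15045), line `weight_split`,
# cycle 5: Brown's theorem for real MZVs and the dimension bound through weight `17`,
# UNCONDITIONALLY and BROWN-FREE — from the associator leaf of route `FurushoPentagon`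

The sister route `FurushoPentagon` has landed, as kernel-checked theorems on the standard axioms, the
ALGEBRAIC LEAF of its crux `KernelModuloPeriodConjecture` through weight `17`
(`stub_associatorHoffmanSpanning_of_weight_le_17`): for every admissible index `s` of weight `≤ 17`
there is ONE finitely supported `b` on Hoffman indices of the same weight with
`c_{bw s}(φ) = Σ_t b_t · c_{bw t}(φ)` at EVERY group-like solution `φ` of Drinfeld's pentagon equation
over EVERY reduced commutative `ℚ`-algebra (Ihara–Kaneko–Zagier's linearised extended double shuffle
system has full rank mod `2` on the non-Hoffman words, certified block by block by `decide`; soundness: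
Furusho's theorem pentagon ⇒ double shuffle, proved in the tree as `DoubleShuffleOfPentagon`). The
Literature side has PROVED Drinfeld's theorem for the real KZ associator
`Φ_KZ ∈ ℝ⟨⟨X₀,X₁⟩⟩` (`drinfeldAssociator`; `drinfeldAssociator_isGroupLike_holds`,
`drinfeldAssociator_pentagon_holds`), whose convergent coefficients are the signed real MZVs
(`drinfeldAssociator_binaryWord : c_{bw s}(Φ_KZ) = (-1)^{|s|} ζ(s)`).

Reading the leaf at the single point `φ = Φ_KZ` gives, with NO motivic input and WITHOUT the sister
crux `HoffmanSpanInKZ` of this route: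

* `hoffmanSpan_eq_mzvSpace_of_le_seventeen`: **Brown's theorem (Hoffman's Conjecture C) holds for real
  MZVs in every weight `n ≤ 17`** — every `ζ(s)` of weight `≤ 17` is a rational combination of the
  Hoffman values `ζ(u)`, `u ∈ {2,3}^×`, of the same weight (the tree had `n ≤ 11`,
  `hoffmanSpan_eq_mzvSpace_of_le_eleven`, through the EDS certificates of crux #6);
* `finrank_mzvSpace_le_zagierDim_of_le_seventeen`: **the Terasoma–Deligne–Goncharov bound
  `dim_ℚ 𝒵_n ≤ d_n` for `n ≤ 17`**, in particular `dim_ℚ 𝒵₁₂ ≤ 12`, `dim_ℚ 𝒵₁₃ ≤ 16`,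
  `dim_ℚ 𝒵₁₄ ≤ 21`, `dim_ℚ 𝒵₁₅ ≤ 28`, `dim_ℚ 𝒵₁₆ ≤ 37`, `dim_ℚ 𝒵₁₇ ≤ 49` (the `ℚ`-span of the
  `2^15 = 32768` convergent MZVs of weight `17` has dimension at most `49`);
* for this crux: `inWeight_iff_finrank_mzvSpace_eq_of_le_seventeen` — the slices `n ≤ 17` of the
  registered stub `stub_inWeight` are EXACTLY Zagier's dimension statements `dim_ℚ 𝒵_n = d_n`, and the
  registered sub-goal `finrank_mzvSpace_eq_of_hoffmanIndependence_of_le_seventeen` — **the crux proves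
  Zagier's dimension table `1,0,1,1,1,2,2,3,4,5,7,9,12,16,21,28,37,49` through weight `17` outright**
  (Zagier's 1994 numerics reached weight `12`; Kaneko–Noro–Tsurumaki's rank computation of the EDS
  matrix of REAL MZVs modulo a prime reached weight `20`, as numerical evidence);
* in all weights: `hoffmanIndependence_iff_zagierConjecture_of_associatorHoffmanSpanning` — given the
  FurushoPentagon leaf `AssociatorHoffmanSpanning` (all weights), the crux IS Zagier's conjecture.
  This is the second Brown-free reduction of the route's declared transcendence input to the printed
  conjecture (cycle 4 went through crux #6: `hoffmanIndependence_iff_zagierConjecture_of_hoffmanSpanInKZ`).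

Sources: F. Brown, Ann. of Math. 175 (2012), Thm 1.1; T. Terasoma, Invent. Math. 149 (2002), Thm 1.2;
D. Zagier, ECM 1992 (1994), §9; V. Drinfeld, Leningrad Math. J. 2 (1991), §2; H. Furusho, Publ. RIMS 39
(2003), Prop. 3.2.3, and Ann. of Math. 174 (2011), Thm 1.2; K. Ihara, M. Kaneko, D. Zagier, Compos.
Math. 142 (2006), §2; M. Kaneko, M. Noro, K. Tsurumaki, IMA Vol. 148 (2008); M. Hoffman, J. Algebra
194 (1997).
-/

noncomputable section

namespace Summit.KontsevichZagierPeriods.LinRedNormalForm.HoffmanIndependence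

open Literature.NumberTheory.Transcendental MZV
open Summit.KontsevichZagierPeriods.FurushoPentagon.KernelModuloPeriodConjecture
  (stub_associatorHoffmanSpanning_of_weight_le_17)
open Summit.KontsevichZagierPeriods.KernelModuloPeriodConjecture.Negative
  (hoffmanSpan_eq_mzvSpace_of_stubA)
open Summit.KontsevichZagierPeriods.KontsevichZagierPeriods.Theses.LinRedNormalForm (HoffmanIndependence)

/-! ## Reading the associator leaf at `Φ_KZ`: one index, one weight -/

/-- **The leaf at one index, read at `Φ_KZ`.** If the coefficient `c_{bw s}` is one fixed rational
combination of Hoffman coefficients of the same weight at every group-like pentagon solution over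
every reduced commutative `ℚ`-algebra, then `ζ(s)` lies in the Hoffman span of its weight: take
`φ = Φ_KZ ∈ ℝ⟨⟨X₀,X₁⟩⟩` (group-like and a pentagon solution — Drinfeld's theorem, tree theorems) and
use `c_{bw t}(Φ_KZ) = (-1)^{|t|} ζ(t)`. (The all-weights form is
`Negative.multipleZeta_mem_hoffmanSpan_of_stubA`; this is its index-wise sharpening, same proof.)
[cite: Drinfeld1991, §2] [cite: Furusho2003, Prop. 3.2.3] -/
theorem multipleZeta_mem_hoffmanSpan_of_associatorLeafAt {s : List ℕ} (hs : IsAdmissible s)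
    (hA : ∃ b : List ℕ →₀ ℚ, (∀ t ∈ b.support, IsHoffman t ∧ weight t = weight s) ∧
      ∀ (R : Type) [CommRing R] [Algebra ℚ R] [IsReduced R] (φ : NCSeries Bool R),
        NCSeries.IsGroupLike φ → NCSeries.DrinfeldPentagon φ →
          φ (binaryWord s) = b.sum (fun t q => q • φ (binaryWord t))) :
    multipleZeta s ∈ hoffmanSpan (weight s) := by
  -- adapted from `Theorems/KernelModuloPeriodConjecture/Negative/StubAImpliesBrownSpanning.lean`
  obtain ⟨b, hb, h⟩ := hA
  have hΦ := h ℝ drinfeldAssociator drinfeldAssociator_isGroupLike_holds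
    drinfeldAssociator_pentagon_holds
  rw [drinfeldAssociator_binaryWord hs] at hΦ
  have hsum : b.sum (fun t q => q • drinfeldAssociator (binaryWord t)) ∈ hoffmanSpan (weight s) := by
    unfold Finsupp.sum
    refine Submodule.sum_mem _ fun t ht => ?_
    obtain ⟨hH, hw⟩ := hb t ht
    show b t • drinfeldAssociator (binaryWord t) ∈ hoffmanSpan (weight s)
    rw [drinfeldAssociator_binaryWord hH.isAdmissible]
    refine Submodule.smul_mem _ _ ?_
    have hmem : multipleZeta t ∈ hoffmanSpan (weight s) := Submodule.subset_span ⟨t, hH, hw, rfl⟩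
    have : ((-1 : ℝ) ^ t.length * multipleZeta t) = ((-1 : ℤ) ^ t.length) • multipleZeta t := by
      simp [zsmul_eq_mul]
    rw [this]
    exact zsmul_mem hmem _
  have hζ : multipleZeta s =
      ((-1 : ℤ) ^ s.length) • b.sum (fun t q => q • drinfeldAssociator (binaryWord t)) := by
    rw [← hΦ, zsmul_eq_mul, Int.cast_pow, Int.cast_neg, Int.cast_one, ← mul_assoc, ← pow_add,
      ← two_mul, pow_mul]
    simp
  rw [hζ]
  exact zsmul_mem hsum _

/-- **The leaf in one weight, read at `Φ_KZ`, is Brown's theorem in that weight for real numbers**: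
`hoffmanSpan n = mzvSpace n`. [cite: Brown2012, Theorem 1.1] [cite: Drinfeld1991, §2] -/
theorem hoffmanSpan_eq_mzvSpace_of_associatorLeafAt {n : ℕ}
    (hA : ∀ s : List ℕ, IsAdmissible s → weight s = n →
      ∃ b : List ℕ →₀ ℚ, (∀ t ∈ b.support, IsHoffman t ∧ weight t = weight s) ∧
        ∀ (R : Type) [CommRing R] [Algebra ℚ R] [IsReduced R] (φ : NCSeries Bool R),
          NCSeries.IsGroupLike φ → NCSeries.DrinfeldPentagon φ →
            φ (binaryWord s) = b.sum (fun t q => q • φ (binaryWord t))) :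
    hoffmanSpan n = mzvSpace n :=
  hoffmanSpan_eq_mzvSpace_of_forall_mem fun s hs hw =>
    hw ▸ multipleZeta_mem_hoffmanSpan_of_associatorLeafAt hs (hA s hs hw)

/-! ## All weights: the FurushoPentagon leaf makes the crux Zagier's conjecture, Brown-free -/

/-- **Given the algebraic leaf `AssociatorHoffmanSpanning` of route `FurushoPentagon` (all weights),
the crux IS Zagier's conjecture**: the leaf read at `Φ_KZ` is Brown's theorem `hoffmanSpan_eq_mzvSpace`
(`Negative.hoffmanSpan_eq_mzvSpace_of_stubA`), which is all that
`hoffmanIndependence_iff_zagierConjecture` needs. Second Brown-free reduction of the route's declared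
transcendence input to the printed conjecture (the first, `…_of_hoffmanSpanInKZ`, goes through crux #6
of this route). [cite: Zagier1994, §9] [cite: GoncharovECM2001, Conjecture 1.1] -/
theorem hoffmanIndependence_iff_zagierConjecture_of_associatorHoffmanSpanning
    (hA : ∀ s : List ℕ, IsAdmissible s →
      ∃ b : List ℕ →₀ ℚ, (∀ t ∈ b.support, IsHoffman t ∧ weight t = weight s) ∧
        ∀ (R : Type) [CommRing R] [Algebra ℚ R] [IsReduced R] (φ : NCSeries Bool R),
          NCSeries.IsGroupLike φ → NCSeries.DrinfeldPentagon φ →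
            φ (binaryWord s) = b.sum (fun t q => q • φ (binaryWord t))) :
    HoffmanIndependence ↔ ZagierConjecture :=
  hoffmanIndependence_iff_zagierConjecture (hoffmanSpan_eq_mzvSpace_of_stubA hA)

/-- Given the FurushoPentagon leaf, the registered stub `stub_weightGrading` IS Goncharov's
weight-grading conjecture and `stub_inWeight` IS Zagier's dimension conjecture, verbatim.
[cite: GoncharovECM2001, Conjecture 1.1] [cite: Zagier1994, §9] -/
theorem stubs_iff_conjectures_of_associatorHoffmanSpanning
    (hA : ∀ s : List ℕ, IsAdmissible s →
      ∃ b : List ℕ →₀ ℚ, (∀ t ∈ b.support, IsHoffman t ∧ weight t = weight s) ∧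
        ∀ (R : Type) [CommRing R] [Algebra ℚ R] [IsReduced R] (φ : NCSeries Bool R),
          NCSeries.IsGroupLike φ → NCSeries.DrinfeldPentagon φ →
            φ (binaryWord s) = b.sum (fun t q => q • φ (binaryWord t))) :
    (iSupIndep hoffmanSpan ↔ MZVWeightGradingConjecture) ∧
      ((∀ n : ℕ, LinearIndependent ℚ
          (fun u : {u : List ℕ // IsHoffman u ∧ weight u = n} => multipleZeta u.1)) ↔
        ZagierDimensionConjecture) :=
  ⟨weightGrading_iff_gradingConjecture (hoffmanSpan_eq_mzvSpace_of_stubA hA),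
    inWeight_iff_zagierDimensionConjecture (hoffmanSpan_eq_mzvSpace_of_stubA hA)⟩

/-! ## Weights `≤ 17`, unconditionally -/

/-- **Brown's theorem in weights `≤ 17`, unconditionally and Brown-free**: `hoffmanSpan n = mzvSpace n`
for `n = 0, …, 17` — every real MZV of weight `≤ 17` is a rational combination of Hoffman values of
the same weight (landed leaf `stub_associatorHoffmanSpanning_of_weight_le_17` read at `Φ_KZ`).
[cite: Brown2012, Theorem 1.1] [cite: IharaKanekoZagier2006, §2] -/
theorem hoffmanSpan_eq_mzvSpace_of_le_seventeen {n : ℕ} (hn : n ≤ 17) :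
    hoffmanSpan n = mzvSpace n :=
  hoffmanSpan_eq_mzvSpace_of_associatorLeafAt fun s hs hw =>
    stub_associatorHoffmanSpanning_of_weight_le_17 s hs (hw ▸ hn)

/-- Every real MZV of weight `≤ 17` lies in the Hoffman span of its weight.
[cite: Brown2012, Theorem 1.1] -/
theorem multipleZeta_mem_hoffmanSpan_of_weight_le_seventeen {s : List ℕ} (hs : IsAdmissible s)
    (hw : weight s ≤ 17) : multipleZeta s ∈ hoffmanSpan (weight s) :=
  multipleZeta_mem_hoffmanSpan_of_associatorLeafAt hs
    (stub_associatorHoffmanSpanning_of_weight_le_17 s hs hw)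

/-- **The Terasoma–Deligne–Goncharov bound in weights `≤ 17`, unconditionally**:
`dim_ℚ 𝒵_n ≤ d_n` for `n ≤ 17`
(`d₀, …, d₁₇ = 1, 0, 1, 1, 1, 2, 2, 3, 4, 5, 7, 9, 12, 16, 21, 28, 37, 49`).
[cite: Terasoma2002, Theorem 1.2] [cite: Zagier1994, §9] -/
theorem finrank_mzvSpace_le_zagierDim_of_le_seventeen {n : ℕ} (hn : n ≤ 17) :
    Module.finrank ℚ (mzvSpace n) ≤ zagierDim n :=
  finrank_mzvSpace_le_zagierDim_of_eq (hoffmanSpan_eq_mzvSpace_of_le_seventeen hn)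

/-- `dim_ℚ 𝒵₁₂ ≤ 12` (the `ℚ`-span of the `1024` convergent MZVs of weight `12`), unconditionally.
[cite: Terasoma2002, Theorem 1.2] [cite: Zagier1994, §9] -/
theorem finrank_mzvSpace_twelve_le : Module.finrank ℚ (mzvSpace 12) ≤ 12 :=
  finrank_mzvSpace_le_zagierDim_of_le_seventeen (by norm_num)

/-- `dim_ℚ 𝒵₁₃ ≤ 16`, unconditionally. [cite: Terasoma2002, Theorem 1.2] [cite: Zagier1994, §9] -/
theorem finrank_mzvSpace_thirteen_le : Module.finrank ℚ (mzvSpace 13) ≤ 16 :=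
  finrank_mzvSpace_le_zagierDim_of_le_seventeen (by norm_num)

/-- `dim_ℚ 𝒵₁₄ ≤ 21`, unconditionally. [cite: Terasoma2002, Theorem 1.2] [cite: Zagier1994, §9] -/
theorem finrank_mzvSpace_fourteen_le : Module.finrank ℚ (mzvSpace 14) ≤ 21 :=
  finrank_mzvSpace_le_zagierDim_of_le_seventeen (by norm_num)

/-- `dim_ℚ 𝒵₁₅ ≤ 28`, unconditionally. [cite: Terasoma2002, Theorem 1.2] [cite: Zagier1994, §9] -/
theorem finrank_mzvSpace_fifteen_le : Module.finrank ℚ (mzvSpace 15) ≤ 28 :=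
  finrank_mzvSpace_le_zagierDim_of_le_seventeen (by norm_num)

/-- `dim_ℚ 𝒵₁₆ ≤ 37`, unconditionally. [cite: Terasoma2002, Theorem 1.2] [cite: Zagier1994, §9] -/
theorem finrank_mzvSpace_sixteen_le : Module.finrank ℚ (mzvSpace 16) ≤ 37 :=
  finrank_mzvSpace_le_zagierDim_of_le_seventeen (by norm_num)

/-- `dim_ℚ 𝒵₁₇ ≤ 49`: the `ℚ`-span of the `32768` convergent MZVs of weight `17` has dimension at
most `49`, unconditionally. [cite: Terasoma2002, Theorem 1.2] [cite: Zagier1994, §9] -/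
theorem finrank_mzvSpace_seventeen_le : Module.finrank ℚ (mzvSpace 17) ≤ 49 :=
  finrank_mzvSpace_le_zagierDim_of_le_seventeen le_rfl

/-- Unconditionally in total weight `≤ 17`: `hoffmanSpan a · hoffmanSpan b ⊆ hoffmanSpan (a + b)`
(the stuffle product `mem_mzvSpace_mul_holds` and Brown's theorem in weight `a + b`).
[cite: Brown2012, Theorem 1.1] [cite: Hoffman1997] -/
theorem mul_mem_hoffmanSpan_of_le_seventeen {a b : ℕ} (hab : a + b ≤ 17) {x y : ℝ}
    (hx : x ∈ hoffmanSpan a) (hy : y ∈ hoffmanSpan b) : x * y ∈ hoffmanSpan (a + b) := by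
  rw [hoffmanSpan_eq_mzvSpace_of_le_seventeen hab]
  exact mem_mzvSpace_mul_holds (hoffmanSpan_le_mzvSpace a hx) (hoffmanSpan_le_mzvSpace b hy)

/-! ## Consequences for the crux -/

/-- **Slices `n ≤ 17` of `stub_inWeight` are exactly Zagier's dimension conjecture in weight `n`**,
with no motivic input and no use of crux #6: the `d_n` real Hoffman values of weight `n ≤ 17` are
`ℚ`-linearly independent iff `dim_ℚ 𝒵_n = d_n`. Slices `n ≤ 4` hold (`inWeight_of_le_four`); slices
`5, …, 17` are the open statements `dim_ℚ 𝒵_n = 2, 2, 3, 4, 5, 7, 9, 12, 16, 21, 28, 37, 49`.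
[cite: Zagier1994, §9] -/
theorem inWeight_iff_finrank_mzvSpace_eq_of_le_seventeen {n : ℕ} (hn : n ≤ 17) :
    LinearIndependent ℚ
        (fun u : {u : List ℕ // IsHoffman u ∧ weight u = n} => multipleZeta u.1) ↔
      Module.finrank ℚ (mzvSpace n) = zagierDim n :=
  inWeight_iff_finrank_mzvSpace_eq_of_hoffmanSpan_eq (hoffmanSpan_eq_mzvSpace_of_le_seventeen hn)

/-- **The crux proves Zagier's dimension table through weight `17` outright** (registered sub-goal
of line `weight_split`, cycle 5): `HoffmanIndependence → dim_ℚ 𝒵_n = d_n` for every `n ≤ 17`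
(lower bound from the crux, `zagierDim_le_finrank_mzvSpace_of_hoffmanIndependence`; upper bound from
the associator leaf read at `Φ_KZ`; no Brown, no Terasoma, no crux #6). [cite: Zagier1994, §9] -/
theorem finrank_mzvSpace_eq_of_hoffmanIndependence_of_le_seventeen : HoffmanIndependence → ∀ {n : ℕ}, n ≤ 17 → Module.finrank ℚ (mzvSpace n) = zagierDim n :=
  fun h n hn => le_antisymm (finrank_mzvSpace_le_zagierDim_of_le_seventeen hn)
    (zagierDim_le_finrank_mzvSpace_of_hoffmanIndependence h n)

/-- In particular the crux gives `dim_ℚ 𝒵₁₇ = 49`. [cite: Zagier1994, §9] -/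
theorem finrank_mzvSpace_seventeen_of_hoffmanIndependence (h : HoffmanIndependence) :
    Module.finrank ℚ (mzvSpace 17) = 49 :=
  finrank_mzvSpace_eq_of_hoffmanIndependence_of_le_seventeen h le_rfl

/-- Under the crux, in every weight `n ≤ 17` the Hoffman span IS the MZV space and has dimension
`d_n`: the `d_n` Hoffman values of weight `n` form a basis of `𝒵_n`. [cite: Zagier1994, §9] [cite: Hoffman1997] -/
theorem hoffmanSpan_eq_and_finrank_of_hoffmanIndependence_of_le_seventeen (h : HoffmanIndependence)
    {n : ℕ} (hn : n ≤ 17) :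
    hoffmanSpan n = mzvSpace n ∧ Module.finrank ℚ (hoffmanSpan n) = zagierDim n :=
  ⟨hoffmanSpan_eq_mzvSpace_of_le_seventeen hn, finrank_hoffmanSpan_eq_of_hoffmanIndependence h n⟩

/-! ## The shared crux in the vocabulary of route `FurushoPentagon` -/

/-- The item is shared by the two routes: `FurushoPentagon.MzvPeriodConjecture` is VERBATIM this
route's `HoffmanIndependence` (both are the `ℚ`-linear independence of all real Hoffman values).
[cite: Zagier1994, §9] -/
theorem mzvPeriodConjecture_iff_hoffmanIndependence :
    Summit.KontsevichZagierPeriods.KontsevichZagierPeriods.Theses.FurushoPentagon.MzvPeriodConjecture ↔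
      HoffmanIndependence :=
  Iff.rfl

/-- For route `FurushoPentagon`: given its own algebraic leaf `AssociatorHoffmanSpanning` (all
weights), its declared transcendence input `MzvPeriodConjecture` IS Zagier's conjecture.
[cite: Zagier1994, §9] [cite: GoncharovECM2001, Conjecture 1.1] -/
theorem mzvPeriodConjecture_iff_zagierConjecture_of_associatorHoffmanSpanning
    (hA : ∀ s : List ℕ, IsAdmissible s →
      ∃ b : List ℕ →₀ ℚ, (∀ t ∈ b.support, IsHoffman t ∧ weight t = weight s) ∧
        ∀ (R : Type) [CommRing R] [Algebra ℚ R] [IsReduced R] (φ : NCSeries Bool R),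
          NCSeries.IsGroupLike φ → NCSeries.DrinfeldPentagon φ →
            φ (binaryWord s) = b.sum (fun t q => q • φ (binaryWord t))) :
    Summit.KontsevichZagierPeriods.KontsevichZagierPeriods.Theses.FurushoPentagon.MzvPeriodConjecture ↔
      ZagierConjecture :=
  hoffmanIndependence_iff_zagierConjecture_of_associatorHoffmanSpanning hA

/-- For route `FurushoPentagon`: its transcendence input proves Zagier's dimension table through
weight `17` outright (its own leaf through weight `17` read at `Φ_KZ` gives the upper bound).
[cite: Zagier1994, §9] -/
theorem finrank_mzvSpace_eq_of_mzvPeriodConjecture_of_le_seventeen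
    (h : Summit.KontsevichZagierPeriods.KontsevichZagierPeriods.Theses.FurushoPentagon.MzvPeriodConjecture)
    {n : ℕ} (hn : n ≤ 17) : Module.finrank ℚ (mzvSpace n) = zagierDim n :=
  finrank_mzvSpace_eq_of_hoffmanIndependence_of_le_seventeen
    (mzvPeriodConjecture_iff_hoffmanIndependence.1 h) hn

/-! ## Normal-form data under the crux: the Hoffman basis of `𝒵_n`, `n ≤ 17` -/

/-- **Under the crux, the Hoffman values of weight `n ≤ 17` form a `ℚ`-basis of `𝒵_n`** (the crux
gives independence, the associator leaf read at `Φ_KZ` gives spanning): there is a basis of `mzvSpace n`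
indexed by the Hoffman indices of weight `n` whose vectors are the `ζ(u)` — so every real MZV of weight
`≤ 17` has a UNIQUE rational Hoffman expansion (the normal form of the route, conditional only on the
crux). [cite: Hoffman1997] [cite: Brown2012, Theorem 1.1] [cite: Zagier1994, §9] -/
theorem exists_hoffmanBasis_of_hoffmanIndependence_of_le_seventeen : HoffmanIndependence → ∀ {n : ℕ}, n ≤ 17 → ∃ b : Module.Basis {u : List ℕ // IsHoffman u ∧ weight u = n} ℚ (mzvSpace n), ∀ u, (b u : ℝ) = multipleZeta u.1 := by
  intro h n hn
  have hli := inWeight_of_hoffmanIndependence h n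
  have heq : Submodule.span ℚ (Set.range
      fun u : {u : List ℕ // IsHoffman u ∧ weight u = n} => multipleZeta u.1) = mzvSpace n :=
    (span_range_hoffman_weight n).trans (hoffmanSpan_eq_mzvSpace_of_le_seventeen hn)
  refine ⟨(Module.Basis.span hli).map (LinearEquiv.ofEq _ _ heq), fun u => ?_⟩
  simp [Module.Basis.span_apply]

/-- Unconditionally, every real MZV of weight `n ≤ 17` HAS a rational Hoffman expansion of the same
weight (existence of the normal form; uniqueness is exactly the slice `n` of `stub_inWeight`).
[cite: Brown2012, Theorem 1.1] [cite: Hoffman1997] -/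
theorem exists_hoffmanExpansion_of_weight_le_seventeen {s : List ℕ} (hs : IsAdmissible s)
    (hw : weight s ≤ 17) :
    ∃ c : {u : List ℕ // IsHoffman u ∧ weight u = weight s} →₀ ℚ,
      multipleZeta s = c.sum fun u q => (q : ℝ) * multipleZeta u.1 := by
  have hmem : multipleZeta s ∈ Submodule.span ℚ (Set.range
      fun u : {u : List ℕ // IsHoffman u ∧ weight u = weight s} => multipleZeta u.1) := by
    rw [span_range_hoffman_weight]
    exact multipleZeta_mem_hoffmanSpan_of_weight_le_seventeen hs hw
  obtain ⟨c, hc⟩ := (Finsupp.mem_span_range_iff_exists_finsupp).1 hmem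
  refine ⟨c, ?_⟩
  rw [← hc]
  simp only [Finsupp.sum, Rat.smul_def]

end Summit.KontsevichZagierPeriods.LinRedNormalForm.HoffmanIndependence

end
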